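import Literature.NumberTheory.LFunctions.ConreyIwaniec2002ThetaOmega
import Literature.NumberTheory.LFunctions.ConreyIwaniec2002Prop64OfV1
import HarnessLib

/-!
# Conrey–Iwaniec (2002), Propositions 3.2/3.3 and Theorems 4.3/4.4 for the class-group theta
# series `θ(z;ψ)` — the registered stubs S3d `stub_voronoi_theta` and P64 S3
# `stub_shifted_convolution`, closed by name

B. Conrey, H. Iwaniec, *Spacing of zeros of Hecke `L`-functions and the class number problem*,
Acta Arith. 103 (2002) 259–312, §§3–4 [held text `paper:arxiv-math_0111012`, p0008–p0013]:
Propositions 3.2/3.3 (the Voronoi-type summation formula for `λ_ψ(n) = Σ_{N𝔞=n}ψ(𝔞)` at every cusp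
`a/c`, (3.14)/(3.21)) and Theorems 4.3/4.4 (the shifted-convolution bound
`Σ_h |D*(g₁,g₂;h) − σ(h)∫g₁(x+h)ḡ₂(x)dx| ≪ (qAB)²X^{3/4}log²(3X)·…` for `λ_ψ`, (4.25)/(4.26)), the
input of Proposition 6.4.

In the cell `landau-siegel/ls-inputs` these are the registered stub S3d `stub_voronoi_theta` of
SKELETON S3 (`theta-circle-method` v8 c3c360958b35d569 :266) and the registered stub S3
`stub_shifted_convolution` of SKELETON P64 (`thm61-cm-convolution` v10 0e4cb98602a713f2 :236). With
V1 `theta_omega` (`ConreyIwaniec2002ThetaOmega.lean`) landed, both follow BY NAME from the tree's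
kernel compositions:

* `voronoi_theta` — **S3d VERBATIM** := `voronoi_theta_of_omega_hecke theta_omega hecke_voronoi`
  (V2 = P64-w5's Proposition 3.1 at weight one; V3 `theta_constants` inside the composition);
* `shifted_convolution` — **P64 S3 VERBATIM** := `shifted_convolution_of_theta_omega theta_omega`
  (`ConreyIwaniec2002Prop64OfV1.lean`: S3a `bump_fourier`, S3b `circle_assembly` &c., S3c
  `bessel_kernel`, S3e `sigma_genus`, S3f `circleMethod_absorb_constants`).

The typed Proposition 6.4 then is `proposition64_of_theta_omega theta_omega` (left to the P64 lead's
closing file). «The programme SEARCHES and TYPES; no claim about Landau–Siegel zeros, Theorems 1–2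
of arXiv:2211.02515 or a repaired Margin232 until a kernel theorem says so.» Nothing here is a
statement about the size of `L(1,χ)`.

## References

* [ConreyIwaniec2002] B. Conrey, H. Iwaniec, Acta Arith. 103 (2002) 259–312: Proposition 3.2
  (3.14)–(3.15), Proposition 3.3 (3.17)–(3.21), Theorem 4.3 (4.25), Theorem 4.4 (4.26), §4 (4.21).
-/

noncomputable section

open scoped NumberField FourierTransform
open Complex MeasureTheory

namespace Literature.NumberTheory.LFunctions

namespace ConreyIwaniec2002

open NumberField Literature.NumberTheory.LFunctions.NumberField

/-- **Propositions 3.2/3.3 for `θ(·;ψ)` — the registered stub S3d `stub_voronoi_theta` VERBATIM**: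
for `q > 4` odd with a primitive quadratic odd character `χ`, `K` with `d_K = −q` and every
`ψ ∈ Ĉl(K)`, the coefficients `λ_ψ` carry a summation datum `IsVoronoiDatum` with
`A = 2π + √q‖L(1,χ)‖`, kernels `J₀((4π/c)√(mx/r))`, main-term coefficients `voronoiMainCoeff`
(`p(c) = √s‖L(1,χ)‖/c` iff `ψ` is the genus character of `s = (c,q)`), unit pseudo-eigenvalues
and dual phases `e(−ā r̄ m/c)`. := `voronoi_theta_of_omega_hecke theta_omega hecke_voronoi`.
[cite: ConreyIwaniec2002, Proposition 3.2 (3.14)–(3.15), Proposition 3.3 (3.17)–(3.21), §4 (4.21)] -/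
theorem voronoi_theta :
    ∀ (q : ℕ) [NeZero q], 4 < q → Odd q → ∀ χ : DirichletCharacter ℂ q,
      χ.IsPrimitive → χ.IsQuadratic → χ.Odd →
        ∀ (K : Type) [Field K] [NumberField K],
          Module.finrank ℚ K = 2 → NumberField.discr K = -(q : ℤ) →
            ∀ (ψ : ClassGroup (𝓞 K) →* ℂˣ),
              ∃ (u : ℕ → ℤ → ℂ) (φ : ℕ → ℕ → ℂ),
                IsVoronoiDatum (2 * Real.pi + Real.sqrt q * ‖χ.LFunction 1‖)
                  (twistCount K (classGroupCharIdealHom ψ))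
                  (ciBesselKernel fun c ↦ q / Nat.gcd c q)
                  (voronoiMainCoeff q ‖χ.LFunction 1‖ ψ) u φ
                  (fun c m ↦ -(((((q / Nat.gcd c q : ℕ) : ZMod c)⁻¹).val : ℤ) * m)) :=
  voronoi_theta_of_omega_hecke theta_omega hecke_voronoi

/-- **Theorems 4.3/4.4 for `λ_ψ` — the registered stub S3 `stub_shifted_convolution` of SKELETON
P64 VERBATIM**: there is an absolute `c > 0` such that for `q > 4` odd with a primitive quadratic
odd character `χ`, `K` with `d_K = −q` and every `ψ ∈ Ĉl(K)`, some `σ` with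
`IsCISigma q ‖L(1,χ)‖ σ` satisfies `ShiftedConvolutionBound λ_ψ σ (c·q⁶)`.
:= `shifted_convolution_of_theta_omega theta_omega` (Kloosterman's circle method in the axiomatic
setting, Theorem 4.1 / Corollary 4.2, fed with `voronoi_theta`).
[cite: ConreyIwaniec2002, Theorem 4.3 (4.25), Theorem 4.4 (4.26), Corollary 4.2 (4.19)] -/
theorem shifted_convolution :
    ∃ c : ℝ, 0 < c ∧
      ∀ (q : ℕ) [NeZero q], 4 < q → Odd q → ∀ χ : DirichletCharacter ℂ q,
        χ.IsPrimitive → χ.IsQuadratic → χ.Odd →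
          ∀ (K : Type) [Field K] [NumberField K],
            Module.finrank ℚ K = 2 → NumberField.discr K = -(q : ℤ) →
              ∀ (ψ : ClassGroup (𝓞 K) →* ℂˣ),
                ∃ σ : ℕ → ℝ, IsCISigma q ‖χ.LFunction 1‖ σ ∧
                  ShiftedConvolutionBound (twistCount K (classGroupCharIdealHom ψ)) σ
                    (c * (q : ℝ) ^ (6 : ℕ)) :=
  shifted_convolution_of_theta_omega theta_omega

end ConreyIwaniec2002

end Literature.NumberTheory.LFunctions

end
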